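import Summits.QuantumFields.QCD.Theorems.HeatSlicedQuarksWilsonLichnerowiczLinks
import Literature.MathematicalPhysics.QuantumLattice.WilsonFermionBlockAveraging

/-!
# Wilson–Lichnerowicz bound (stmt-QuantumFields-8874): the Wilson–Dirac operator in transport form

* `wilsonDirac_mulVec`: `(wilsonDirac ρ₃ U m 1) v = m v + Σ_μ hop U μ v` with
  `hop U μ = ½(K_μ + γ_μ a_μ)`, `K_μ = 2 - T_μ - T_μ†`, `a_μ = T_μ - T_μ†`
  (via the tree's `wilsonDirac_eq`, `wilsonHopFwd`, `wilsonHopBwd`);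
* single-direction identities: `Re⟨v, E_μ v⟩ = ½‖(1-T_μ)v‖²` (Wilson-term accretivity) and
  `‖E_μ v‖² = ‖(1-T_μ)v‖²`;
* cross-term identities for two directions: `Re⟨K_μv, K_νv⟩ = ‖(1-T_μ)(1-T_ν)v‖² + commutator`,
  `Re⟨K_μv, γ_νa_νv⟩ = ½Re⟨γ_νv, [K_μ,a_ν]v⟩`, `Re⟨γ_μa_μv, γ_νa_νv⟩ = -½Re⟨γ_νγ_μv, [a_μ,a_ν]v⟩`
  (`μ ≠ ν`), and the expansion of `[K_μ,a_ν]`, `[a_μ,a_ν]` into four link commutators each.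
-/

noncomputable section

namespace Summit.QuantumFields.QCD.Theorems.WilsonLichnerowicz

open Literature.Probability.LatticeModels Matrix
open scoped ComplexConjugate

variable {L : ℕ}

/-! ## The Wilson–Dirac operator in transport form -/

section Dirac

open Literature.MathematicalPhysics.QuantumLattice Literature.MathematicalPhysics.QuantumFieldTheory


variable [NeZero L]

/-- The forward Wilson hopping matrix acts as `(1 - γ_μ) T_μ`. -/
theorem wilsonHopFwd_mulVec (U : GaugeConfig 4 L SU3) (μ : Fin 4) (v : Fld L) :
    (wilsonHopFwd (fundamentalRep (Fin 3)) U 1 μ).mulVec v =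
      fwd U μ v - spin (euclideanGamma μ) (fwd U μ v) := by
  funext p
  obtain ⟨x, a, α⟩ := p
  simp only [Matrix.mulVec, dotProduct, wilsonHopFwd, Matrix.of_apply, Fintype.sum_prod_type,
    ite_mul, zero_mul, Pi.sub_apply, spin_apply]
  rw [Finset.sum_comm]
  simp only [Finset.sum_ite_irrel, Finset.sum_const_zero, Finset.sum_ite_eq', Finset.mem_univ,
    if_true, fwd, transport_apply, Literature.MathematicalPhysics.QuantumFieldTheory.Site.shift,
    fundamentalRep_apply,
    Matrix.sub_apply, Matrix.one_apply, Complex.ofReal_one, one_smul, sub_mul, ite_mul, one_mul,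
    zero_mul, Finset.sum_sub_distrib, Finset.sum_ite_eq, Finset.mul_sum]
  congr 1
  rw [Finset.sum_comm]
  exact Finset.sum_congr rfl fun β _ => Finset.sum_congr rfl fun b _ => by ring

/-- The backward Wilson hopping matrix acts as `(1 + γ_μ) T_μ†`. -/
theorem wilsonHopBwd_mulVec (U : GaugeConfig 4 L SU3) (μ : Fin 4) (v : Fld L) :
    (wilsonHopBwd (fundamentalRep (Fin 3)) U 1 μ).mulVec v =
      bwd U μ v + spin (euclideanGamma μ) (bwd U μ v) := by
  funext p
  obtain ⟨x, a, α⟩ := p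
  have hshift : ∀ y : TorusSite 4 L,
      (x = Literature.MathematicalPhysics.QuantumFieldTheory.Site.shift y μ) ↔
        (y = x - Pi.single μ 1) := by
    intro y
    simp only [Literature.MathematicalPhysics.QuantumFieldTheory.Site.shift]
    constructor
    · rintro rfl; rw [add_sub_cancel_right]
    · rintro rfl; rw [sub_add_cancel]
  simp only [Matrix.mulVec, dotProduct, wilsonHopBwd, Matrix.of_apply, Fintype.sum_prod_type,
    ite_mul, zero_mul, Pi.add_apply, spin_apply, hshift]
  rw [Finset.sum_comm]
  simp only [Finset.sum_ite_irrel, Finset.sum_const_zero, Finset.sum_ite_eq', Finset.mem_univ,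
    if_true, bwd, transport_apply, fundamentalRep_apply, ← sub_eq_add_neg,
    Matrix.add_apply, Matrix.one_apply, Complex.ofReal_one, one_smul, add_mul, ite_mul, one_mul,
    zero_mul, Finset.sum_add_distrib, Finset.sum_ite_eq, Finset.mul_sum]
  congr 1
  rw [Finset.sum_comm]
  exact Finset.sum_congr rfl fun β _ => Finset.sum_congr rfl fun b _ => by ring

/-- **Transport form of the Wilson–Dirac operator** (`r = 1`):
`D_W v = m v + Σ_μ E_μ v` with `E_μ = ½((2 - T_μ - T_μ†) + γ_μ (T_μ - T_μ†))`. -/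
theorem wilsonDirac_mulVec (U : GaugeConfig 4 L SU3) (m : ℝ) (v : Fld L) :
    (wilsonDirac (fundamentalRep (Fin 3)) U m 1).mulVec v = (m : ℂ) • v + ∑ μ, hop U μ v := by
  rw [wilsonDirac_eq, Matrix.sub_mulVec, Matrix.smul_mulVec, Matrix.one_mulVec, Matrix.smul_mulVec,
    Matrix.sum_mulVec]
  simp only [Matrix.add_mulVec, wilsonHopFwd_mulVec, wilsonHopBwd_mulVec, hop_apply, lapK_apply,
    asym_apply, map_sub, ← Finset.smul_sum]
  simp only [Finset.sum_add_distrib, Finset.sum_sub_distrib, Finset.sum_const, Finset.card_univ,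
    Fintype.card_fin, Complex.ofReal_add, Complex.ofReal_ofNat, mul_one]
  module

/-! ### Single-direction identities -/

/-- `K_μ` is symmetric. -/
theorem ip_lapK_left (U : GaugeConfig 4 L SU3) (μ : Fin 4) (p q : Fld L) :
    ip (lapK U μ p) q = ip p (lapK U μ q) := by
  simp only [lapK_apply, ip_sub_left, ip_sub_right, ip_smul_left, ip_smul_right, ip_fwd, ip_bwd,
    map_ofNat]
  ring

/-- `a_μ` is antisymmetric. -/
theorem ip_asym_right (U : GaugeConfig 4 L SU3) (μ : Fin 4) (p q : Fld L) :
    ip p (asym U μ q) = -ip (asym U μ p) q := by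
  simp only [asym_apply, ip_sub_left, ip_sub_right, ip_fwd, ip_bwd]
  ring

omit [NeZero L] in
/-- `K_μ` and `a_μ` commute (both are functions of the unitary `T_μ`). -/
theorem lapK_asym_comm (U : GaugeConfig 4 L SU3) (μ : Fin 4) (v : Fld L) :
    lapK U μ (asym U μ v) = asym U μ (lapK U μ v) := by
  simp only [lapK_apply, asym_apply, map_sub, map_smul, fwd_bwd, bwd_fwd]
  module

omit [NeZero L] in
/-- Spin matrices commute with `K_ν`. -/
theorem spin_lapK (Γ : Matrix (Fin 4) (Fin 4) ℂ) (U : GaugeConfig 4 L SU3) (ν : Fin 4) (v : Fld L) :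
    spin Γ (lapK U ν v) = lapK U ν (spin Γ v) := by
  simp only [lapK_apply, map_sub, map_smul, spin_fwd, spin_bwd]

omit [NeZero L] in
/-- Spin matrices commute with `a_ν`. -/
theorem spin_asym (Γ : Matrix (Fin 4) (Fin 4) ℂ) (U : GaugeConfig 4 L SU3) (ν : Fin 4) (v : Fld L) :
    spin Γ (asym U ν v) = asym U ν (spin Γ v) := by
  simp only [asym_apply, map_sub, spin_fwd, spin_bwd]

/-- `Re⟨v, K_μ v⟩ = ‖v - T_μ v‖²`. -/
theorem re_ip_lapK (U : GaugeConfig 4 L SU3) (μ : Fin 4) (v : Fld L) :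
    (ip v (lapK U μ v)).re = nsq (v - fwd U μ v) := by
  rw [lapK_apply, ip_sub_right, ip_sub_right, ip_smul_right, ip_bwd, nsq_sub, nsq_fwd, ← re_ip_self,
    Complex.sub_re, Complex.sub_re, re_ip_comm (fwd U μ v) v]
  simp only [Complex.mul_re, Complex.re_ofNat, Complex.im_ofNat, zero_mul, sub_zero]
  ring

/-- `Re⟨v, γ_μ a_μ v⟩ = 0`. -/
theorem re_ip_spin_asym (U : GaugeConfig 4 L SU3) (μ : Fin 4) (v : Fld L) :
    (ip v (spin (euclideanGamma μ) (asym U μ v))).re = 0 := by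
  rw [ip_gamma, asym_apply, ip_sub_right, ip_bwd, ← spin_fwd]
  have h : ip (spin (euclideanGamma μ) (fwd U μ v)) v =
      conj (ip (spin (euclideanGamma μ) v) (fwd U μ v)) := by
    rw [conj_ip, ip_gamma]
  rw [h, Complex.sub_re, Complex.conj_re, sub_self]

/-- `‖K_μ v‖² + ‖a_μ v‖² = 4 ‖v - T_μ v‖²` (from `K_μ² - a_μ² = 4 K_μ`). -/
theorem nsq_lapK_add_nsq_asym (U : GaugeConfig 4 L SU3) (μ : Fin 4) (v : Fld L) :
    nsq (lapK U μ v) + nsq (asym U μ v) = 4 * nsq (v - fwd U μ v) := by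
  have h1 : lapK U μ v = (v - fwd U μ v) + (v - bwd U μ v) := by
    rw [lapK_apply, two_smul]; abel
  have h2 : asym U μ v = (v - bwd U μ v) - (v - fwd U μ v) := by
    rw [asym_apply]; abel
  have h3 : nsq (v - bwd U μ v) = nsq (v - fwd U μ v) := by
    rw [nsq_sub, nsq_sub, nsq_fwd, nsq_bwd, ip_bwd, re_ip_comm]
  rw [h1, h2, nsq_add (v - fwd U μ v) (v - bwd U μ v), nsq_sub (v - bwd U μ v) (v - fwd U μ v),
    re_ip_comm (v - bwd U μ v) (v - fwd U μ v), h3]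
  ring

/-- `Re⟨K_μ v, γ_μ a_μ v⟩ = 0`. -/
theorem re_ip_lapK_spin_asym (U : GaugeConfig 4 L SU3) (μ : Fin 4) (v : Fld L) :
    (ip (lapK U μ v) (spin (euclideanGamma μ) (asym U μ v))).re = 0 := by
  have h : ip (lapK U μ v) (spin (euclideanGamma μ) (asym U μ v)) =
      -conj (ip (lapK U μ v) (spin (euclideanGamma μ) (asym U μ v))) :=
    calc ip (lapK U μ v) (spin (euclideanGamma μ) (asym U μ v))
        = ip (spin (euclideanGamma μ) (lapK U μ v)) (asym U μ v) := ip_gamma _ _ _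
      _ = ip (lapK U μ (spin (euclideanGamma μ) v)) (asym U μ v) := by rw [spin_lapK]
      _ = ip (spin (euclideanGamma μ) v) (lapK U μ (asym U μ v)) := ip_lapK_left _ _ _ _
      _ = ip (spin (euclideanGamma μ) v) (asym U μ (lapK U μ v)) := by rw [lapK_asym_comm]
      _ = -ip (asym U μ (spin (euclideanGamma μ) v)) (lapK U μ v) := ip_asym_right _ _ _ _
      _ = -ip (spin (euclideanGamma μ) (asym U μ v)) (lapK U μ v) := by rw [spin_asym]
      _ = -conj (ip (lapK U μ v) (spin (euclideanGamma μ) (asym U μ v))) := by rw [conj_ip]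
  have h2 := congrArg Complex.re h
  rw [Complex.neg_re, Complex.conj_re] at h2
  linarith

/-- The scalar `½` on the real part. -/
private theorem re_half_mul (z : ℂ) : ((1 / 2 : ℂ) * z).re = 1 / 2 * z.re := by
  have h : (1 / 2 : ℂ) = ((1 / 2 : ℝ) : ℂ) := by push_cast; ring
  rw [h, Complex.re_ofReal_mul]

/-- **Wilson-term accretivity, per direction**: `Re⟨v, E_μ v⟩ = ½ ‖v - T_μ v‖²`. -/
theorem re_ip_hop (U : GaugeConfig 4 L SU3) (μ : Fin 4) (v : Fld L) :
    (ip v (hop U μ v)).re = 1 / 2 * nsq (v - fwd U μ v) := by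
  rw [hop_apply, ip_smul_right, re_half_mul, ip_add_right, Complex.add_re, re_ip_lapK,
    re_ip_spin_asym, add_zero]

/-- **The hopping term is a partial isometry scale**: `‖E_μ v‖² = ‖v - T_μ v‖²`. -/
theorem nsq_hop (U : GaugeConfig 4 L SU3) (μ : Fin 4) (v : Fld L) :
    nsq (hop U μ v) = nsq (v - fwd U μ v) := by
  rw [hop_apply, nsq_smul, nsq_add, nsq_gamma, re_ip_lapK_spin_asym, mul_zero, add_zero,
    nsq_lapK_add_nsq_asym]
  norm_num
  ring

/-! ### Cross terms between two directions -/

/-- `Re⟨K_μ v, K_ν v⟩ = ‖(1 - T_μ)(1 - T_ν) v‖² + Re⟨([T_ν,T_μ] + [T_ν,T_μ†]) v, (1 - T_ν) v⟩`. -/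
theorem re_ip_lapK_lapK (U : GaugeConfig 4 L SU3) (μ ν : Fin 4) (v : Fld L) :
    (ip (lapK U μ v) (lapK U ν v)).re =
      nsq ((v - fwd U ν v) - fwd U μ (v - fwd U ν v)) +
        (ip (fwd U ν (fwd U μ v) - fwd U μ (fwd U ν v) +
            (fwd U ν (bwd U μ v) - bwd U μ (fwd U ν v))) (v - fwd U ν v)).re := by
  have h1 : lapK U ν v = (v - fwd U ν v) - bwd U ν (v - fwd U ν v) := by
    rw [lapK_apply, map_sub, bwd_fwd, two_smul]; abel
  have h2 : lapK U μ v - fwd U ν (lapK U μ v) =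
      lapK U μ (v - fwd U ν v) + (fwd U ν (fwd U μ v) - fwd U μ (fwd U ν v) +
        (fwd U ν (bwd U μ v) - bwd U μ (fwd U ν v))) := by
    simp only [lapK_apply, map_sub, map_smul]; abel
  rw [h1, ip_sub_right, ip_bwd, ← ip_sub_left, h2, ip_add_left, Complex.add_re, ip_lapK_left,
    re_ip_lapK]

/-- `Re⟨K_μ v, γ_ν a_ν v⟩ = ½ Re⟨γ_ν v, [K_μ, a_ν] v⟩`. -/
theorem re_ip_lapK_spin_asym_two (U : GaugeConfig 4 L SU3) (μ ν : Fin 4) (v : Fld L) :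
    (ip (lapK U μ v) (spin (euclideanGamma ν) (asym U ν v))).re =
      1 / 2 * (ip (spin (euclideanGamma ν) v)
        (lapK U μ (asym U ν v) - asym U ν (lapK U μ v))).re := by
  have hA : ip (spin (euclideanGamma ν) v) (lapK U μ (asym U ν v)) =
      ip (lapK U μ v) (spin (euclideanGamma ν) (asym U ν v)) := by
    rw [← ip_lapK_left, ← spin_lapK, ← ip_gamma]
  have hB : ip (spin (euclideanGamma ν) v) (asym U ν (lapK U μ v)) =
      -conj (ip (lapK U μ v) (spin (euclideanGamma ν) (asym U ν v))) := by
    rw [ip_asym_right, ← spin_asym, conj_ip]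
  rw [ip_sub_right, hA, hB, Complex.sub_re, Complex.neg_re, Complex.conj_re]
  ring

/-- `⟨γ_μ a_μ v, γ_ν a_ν v⟩ = -⟨γ_ν γ_μ v, a_μ a_ν v⟩`. -/
theorem ip_spin_asym_spin_asym (U : GaugeConfig 4 L SU3) (μ ν : Fin 4) (v : Fld L) :
    ip (spin (euclideanGamma μ) (asym U μ v)) (spin (euclideanGamma ν) (asym U ν v)) =
      -ip (spin (euclideanGamma ν) (spin (euclideanGamma μ) v)) (asym U μ (asym U ν v)) := by
  rw [ip_gamma, spin_asym, spin_asym, ← neg_neg (ip (asym U μ _) _), ← ip_asym_right]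

/-- `Re⟨γ_μ a_μ v, γ_ν a_ν v⟩ = -½ Re⟨γ_ν γ_μ v, [a_μ, a_ν] v⟩` for `μ ≠ ν`. -/
theorem re_ip_spin_asym_spin_asym (U : GaugeConfig 4 L SU3) {μ ν : Fin 4} (h : μ ≠ ν) (v : Fld L) :
    (ip (spin (euclideanGamma μ) (asym U μ v)) (spin (euclideanGamma ν) (asym U ν v))).re =
      -(1 / 2) * (ip (spin (euclideanGamma ν) (spin (euclideanGamma μ) v))
        (asym U μ (asym U ν v) - asym U ν (asym U μ v))).re := by
  have h1 := ip_spin_asym_spin_asym U μ ν v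
  have h2 : (ip (spin (euclideanGamma μ) (asym U μ v)) (spin (euclideanGamma ν) (asym U ν v))).re =
      (ip (spin (euclideanGamma ν) (spin (euclideanGamma μ) v)) (asym U ν (asym U μ v))).re := by
    rw [re_ip_comm, ip_spin_asym_spin_asym, gamma_anticomm h, ip_neg_left, neg_neg]
  rw [ip_sub_right, Complex.sub_re, ← h2, h1, Complex.neg_re]
  ring

omit [NeZero L] in
/-- `[K_μ, a_ν]` as a signed sum of four link commutators. -/
theorem lapK_asym_sub (U : GaugeConfig 4 L SU3) (μ ν : Fin 4) (v : Fld L) :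
    lapK U μ (asym U ν v) - asym U ν (lapK U μ v) =
      -(fwd U μ (fwd U ν v) - fwd U ν (fwd U μ v)) + (fwd U μ (bwd U ν v) - bwd U ν (fwd U μ v)) +
        -(bwd U μ (fwd U ν v) - fwd U ν (bwd U μ v)) + (bwd U μ (bwd U ν v) - bwd U ν (bwd U μ v)) := by
  simp only [lapK_apply, asym_apply, map_sub, map_smul]
  module

omit [NeZero L] in
/-- `[a_μ, a_ν]` as a signed sum of four link commutators. -/
theorem asym_asym_sub (U : GaugeConfig 4 L SU3) (μ ν : Fin 4) (v : Fld L) :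
    asym U μ (asym U ν v) - asym U ν (asym U μ v) =
      (fwd U μ (fwd U ν v) - fwd U ν (fwd U μ v)) + -(fwd U μ (bwd U ν v) - bwd U ν (fwd U μ v)) +
        -(bwd U μ (fwd U ν v) - fwd U ν (bwd U μ v)) + (bwd U μ (bwd U ν v) - bwd U ν (bwd U μ v)) := by
  simp only [asym_apply, map_sub]
  abel

end Dirac


end Summit.QuantumFields.QCD.Theorems.WilsonLichnerowicz
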